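import Summits.QuantumFields.YangMills.Theorems.SwapVirialDeficitZeroModeGroupFourSmallBallTwoScaleLimit
import HarnessLib

/-!
# Exact zero-mode rung, FOUR pairwise nearly commuting letters — IX: JOINT continuity of `vol³(T(η, ζ, κ))` at the origin
# (zero-mode block of crux ⟨stmt-QuantumFields-24497⟩ `ToronTubeVolumeLaw`; free-hands support of ⟨stmt-QuantumFields-24197⟩ / ⟨24497⟩)

In the radial formula (part VII) the three parameters `(η, ζ, κ) = (ρ²/(a₀²+ρ²), t²(a₀²+ρ²)/(4ρ²), t²(a₀²+ρ²)²/(4ρ⁴))` tend to `0` JOINTLY on the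
logarithmic range `√t ≪ ρ ≪ 1`; the coefficient of `log(1/t)` is therefore governed by the joint limit
★★★ `tendsto_volume_twoScale_origin` : `vol³(T(η, ζ, κ)) → h(0) = vol³(T(0,0,0))` as `(η, ζ, κ) → 0` within the octant `η, ζ, κ ≥ 0`
(dominated convergence with the majorant ✓`domSet4`; off the null boundary of `T(0,0,0)` (✓`ae_not_boundary4 0`) each of the nine constraints is
eventually decided by its value at the origin, §31).  Together with ✓`volume_twoScaleSet4_le_decay` (VIII-c: `≤ C·κ^{-1/4}`), ✓`volume_domSet4_lt_top`
(IV-c), ✓`volume_twoScale_limit_pos` (VI) and ✓`haar_nearlyCommuting_eq_radial` (VII), this leaves for `N₄(t)/(t⁶ log(1/t)) → w₄ = π·coneConst⁴·h(0)/64`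
only one-dimensional real analysis (split `ρ ≶ A√t`, `ρ ≶ δ`).
HONEST LABEL: finite-dimensional measure theory on `SU(2)⁴` (plan-level zero-mode rung of DRAFT lines); NOT ⟨24497⟩, NOT ⟨24197⟩; the Yang–Mills mass gap
is NOT proved; no summit is proved by a line.  Seat ym-line-fcl-p3 g44 (cell ym-idea-1, free hands), `--supports stmt-QuantumFields-24197`.  THEOREMS ONLY
(one auxiliary def `octant3`), standard axioms.  References: [cite: GonzalezarroyoAltes1988]; [cite: Vanbaal2001]; [folklore].
-/

set_option autoImplicit false

noncomputable section

open MeasureTheory Quaternion Set Filter Topology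
open scoped Quaternion ENNReal BigOperators
open Literature.MathematicalPhysics.QuantumLattice
open Summit.QuantumFields.YangMills.Theorems.SwapTwistDeficit.ToronLog

attribute [local instance] Literature.Analysis.FluidPDE.Tao2016.quatMeasurableSpace
  Literature.Analysis.FluidPDE.Tao2016.quatBorelSpace
  Literature.MathematicalPhysics.QuantumLattice.secondCountableTopology_su2

namespace Summit.QuantumFields.YangMills.Theorems.SwapVirialDeficit.ZeroModeGroup

/-! ## §31 Persistence of strict inequalities under joint perturbation -/

/-- If `g x₀ < h x₀` for functions continuous at `x₀`, then `g < h` near `x₀`. [folklore] -/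
theorem eventually_lt_of_continuousAt {X : Type*} [TopologicalSpace X] {x₀ : X} {g h : X → ℝ}
    (hg : ContinuousAt g x₀) (hh : ContinuousAt h x₀) (h0 : g x₀ < h x₀) : ∀ᶠ x in 𝓝 x₀, g x < h x :=
  hg.eventually_lt hh h0

/-- A constraint `g ≤ h` with `g x₀ ≠ h x₀` is decided near `x₀` by its value at `x₀`. [folklore] -/
theorem eventually_le_iff_of_continuousAt {X : Type*} [TopologicalSpace X] {x₀ : X} {g h : X → ℝ}
    (hg : ContinuousAt g x₀) (hh : ContinuousAt h x₀) (h0 : g x₀ ≠ h x₀) : ∀ᶠ x in 𝓝 x₀, (g x ≤ h x ↔ g x₀ ≤ h x₀) := by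
  rcases lt_or_gt_of_ne h0 with hlt | hgt
  · filter_upwards [eventually_lt_of_continuousAt hg hh hlt] with x hx
    exact ⟨fun _ => hlt.le, fun _ => hx.le⟩
  · filter_upwards [eventually_lt_of_continuousAt hh hg hgt] with x hx
    exact ⟨fun h1 => absurd (lt_of_le_of_lt h1 hx) (lt_irrefl _), fun h1 => absurd (lt_of_le_of_lt h1 hgt) (lt_irrefl _)⟩

/-- A constraint `g < h` with `g x₀ ≠ h x₀` is decided near `x₀` by its value at `x₀`. [folklore] -/
theorem eventually_lt_iff_of_continuousAt {X : Type*} [TopologicalSpace X] {x₀ : X} {g h : X → ℝ}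
    (hg : ContinuousAt g x₀) (hh : ContinuousAt h x₀) (h0 : g x₀ ≠ h x₀) : ∀ᶠ x in 𝓝 x₀, (g x < h x ↔ g x₀ < h x₀) := by
  rcases lt_or_gt_of_ne h0 with hlt | hgt
  · filter_upwards [eventually_lt_of_continuousAt hg hh hlt] with x hx
    exact ⟨fun _ => hlt, fun _ => hx⟩
  · filter_upwards [eventually_lt_of_continuousAt hh hg hgt] with x hx
    exact ⟨fun h1 => absurd (h1.trans hx) (lt_irrefl _), fun h1 => absurd (h1.trans hgt) (lt_irrefl _)⟩

/-- `p ↦ M_{p.1, p.2.1}(x)` is continuous on `ℝ × ℝ × ℝ`. [folklore] -/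
theorem continuous_tsNorm_joint (x : ℍ) : Continuous fun p : ℝ × ℝ × ℝ => tsNorm p.1 p.2.1 x := by
  unfold tsNorm; fun_prop

/-! ## §32 Eventual constancy off the boundary, jointly in `(η, ζ, κ)` -/

/-- ★ Off the boundary of `T(0,0,0)`, membership of `w` in `T(η, ζ, κ)` is decided at the origin for all `(η, ζ, κ)` near `0`. [folklore] -/
theorem mem_twoScale_eventually_iff_joint (w : (ℍ × ℍ) × ℍ)
    (hw : (w.1.1.re ^ 2 ≠ 1 ∧ w.1.2.re ^ 2 ≠ 1 ∧ w.2.re ^ 2 ≠ 1) ∧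
      (tvSq w.1.1 ≠ w.1.1.re ^ 2 ∧ tvSq w.1.2 ≠ w.1.2.re ^ 2 ∧ tvSq w.2 ≠ w.2.re ^ 2) ∧
      (pairK 0 w.1.1 w.1.2 ≠ w.1.1.re ^ 2 * w.1.2.re ^ 2 ∧ pairK 0 w.1.1 w.2 ≠ w.1.1.re ^ 2 * w.2.re ^ 2 ∧
        pairK 0 w.1.2 w.2 ≠ w.1.2.re ^ 2 * w.2.re ^ 2)) :
    ∀ᶠ p in 𝓝 (0 : ℝ × ℝ × ℝ), (w ∈ twoScaleSet4 p.1 p.2.1 p.2.2 ↔ w ∈ twoScaleSet4 0 0 0) := by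
  obtain ⟨⟨x, y⟩, z⟩ := w
  obtain ⟨⟨b1, b2, b3⟩, ⟨h1, h2, h3⟩, ⟨p1, p2, p3⟩⟩ := hw
  simp only [pairK, pairSq, zero_mul, add_zero] at p1 p2 p3
  -- balls
  have eb : ∀ {u : ℍ}, u.re ^ 2 ≠ 1 → ∀ᶠ p in 𝓝 (0 : ℝ × ℝ × ℝ), (tsNorm p.1 p.2.1 u < 1 ↔ tsNorm 0 0 u < 1) := by
    intro u hu
    have h0 : (fun p : ℝ × ℝ × ℝ => tsNorm p.1 p.2.1 u) 0 ≠ (fun _ : ℝ × ℝ × ℝ => (1 : ℝ)) 0 := by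
      simp only [Prod.fst_zero, Prod.snd_zero, tsNorm_zero_zero]; exact hu
    exact eventually_lt_iff_of_continuousAt (continuous_tsNorm_joint u).continuousAt continuousAt_const h0
  -- hubs
  have eh : ∀ {u : ℍ}, tvSq u ≠ u.re ^ 2 → ∀ᶠ p in 𝓝 (0 : ℝ × ℝ × ℝ),
      (u.imJ ^ 2 + u.imK ^ 2 ≤ tsNorm p.1 p.2.1 u ↔ u.imJ ^ 2 + u.imK ^ 2 ≤ tsNorm 0 0 u) := by
    intro u hu
    have h0 : (fun _ : ℝ × ℝ × ℝ => u.imJ ^ 2 + u.imK ^ 2) 0 ≠ (fun p : ℝ × ℝ × ℝ => tsNorm p.1 p.2.1 u) 0 := by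
      simp only [Prod.fst_zero, Prod.snd_zero, tsNorm_zero_zero]; exact hu
    exact eventually_le_iff_of_continuousAt continuousAt_const (continuous_tsNorm_joint u).continuousAt h0
  -- pairs
  have ep : ∀ {u v : ℍ}, (u.imK * v.imI - u.imI * v.imK) ^ 2 + (u.imI * v.imJ - u.imJ * v.imI) ^ 2 ≠ u.re ^ 2 * v.re ^ 2 →
      ∀ᶠ p in 𝓝 (0 : ℝ × ℝ × ℝ),
        ((u.imK * v.imI - u.imI * v.imK) ^ 2 + (u.imI * v.imJ - u.imJ * v.imI) ^ 2 + p.2.2 * (u.imJ * v.imK - u.imK * v.imJ) ^ 2 ≤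
            tsNorm p.1 p.2.1 u * tsNorm p.1 p.2.1 v ↔
          (u.imK * v.imI - u.imI * v.imK) ^ 2 + (u.imI * v.imJ - u.imJ * v.imI) ^ 2 + 0 * (u.imJ * v.imK - u.imK * v.imJ) ^ 2 ≤
            tsNorm 0 0 u * tsNorm 0 0 v) := by
    intro u v huv
    have hg : Continuous fun p : ℝ × ℝ × ℝ =>
        (u.imK * v.imI - u.imI * v.imK) ^ 2 + (u.imI * v.imJ - u.imJ * v.imI) ^ 2 + p.2.2 * (u.imJ * v.imK - u.imK * v.imJ) ^ 2 := by fun_prop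
    have hh : Continuous fun p : ℝ × ℝ × ℝ => tsNorm p.1 p.2.1 u * tsNorm p.1 p.2.1 v :=
      (continuous_tsNorm_joint u).mul (continuous_tsNorm_joint v)
    have h0 : (fun p : ℝ × ℝ × ℝ =>
        (u.imK * v.imI - u.imI * v.imK) ^ 2 + (u.imI * v.imJ - u.imJ * v.imI) ^ 2 + p.2.2 * (u.imJ * v.imK - u.imK * v.imJ) ^ 2) 0 ≠
        (fun p : ℝ × ℝ × ℝ => tsNorm p.1 p.2.1 u * tsNorm p.1 p.2.1 v) 0 := by
      simp only [Prod.fst_zero, Prod.snd_zero, tsNorm_zero_zero, zero_mul, add_zero]; exact huv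
    have := eventually_le_iff_of_continuousAt hg.continuousAt hh.continuousAt h0
    refine this.mono fun p hp => ?_
    simp only [Prod.snd_zero] at hp
    exact hp
  filter_upwards [eb b1, eb b2, eb b3, eh h1, eh h2, eh h3, ep p1, ep p2, ep p3] with p k1 k2 k3 k4 k5 k6 k7 k8 k9
  simp only [twoScaleSet4, Set.mem_setOf_eq]
  rw [k1, k2, k3, k4, k5, k6, k7, k8, k9]

/-! ## §33 The joint limit at the origin -/

/-- The closed octant `η, ζ, κ ≥ 0` of the parameter space. [folklore] -/
def octant3 : Set (ℝ × ℝ × ℝ) := {p | 0 ≤ p.1 ∧ 0 ≤ p.2.1 ∧ 0 ≤ p.2.2}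

/-- Within the octant, the event lies in the majorant. [folklore] -/
theorem eventually_twoScale_subset_domSet4_joint :
    ∀ᶠ p in 𝓝[octant3] (0 : ℝ × ℝ × ℝ), twoScaleSet4 p.1 p.2.1 p.2.2 ⊆ domSet4 := by
  filter_upwards [self_mem_nhdsWithin] with p hp
  exact twoScaleSet4_subset_domSet4 hp.1 hp.2.1 hp.2.2

/-- ★★★ **JOINT CONTINUITY AT THE ORIGIN**: `vol³(T(η, ζ, κ)) → h(0) = vol³(T(0,0,0))` as `(η, ζ, κ) → (0,0,0)` within `η, ζ, κ ≥ 0`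
(dominated convergence: majorant ✓`domSet4` of finite volume, indicator convergence off the null boundary ✓`ae_not_boundary4 0`). [folklore] -/
theorem tendsto_volume_twoScale_origin :
    Tendsto (fun p : ℝ × ℝ × ℝ => (((volume : Measure ℍ).prod (volume : Measure ℍ)).prod (volume : Measure ℍ)) (twoScaleSet4 p.1 p.2.1 p.2.2))
      (𝓝[octant3] (0 : ℝ × ℝ × ℝ)) (𝓝 ((((volume : Measure ℍ).prod (volume : Measure ℍ)).prod (volume : Measure ℍ)) (twoScaleSet4 0 0 0))) := by
  refine tendsto_measure_of_ae_tendsto_indicator (𝓝[octant3] (0 : ℝ × ℝ × ℝ)) (measurableSet_twoScaleSet4 0 0 0)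
    (fun p => measurableSet_twoScaleSet4 p.1 p.2.1 p.2.2) measurableSet_domSet4 volume_domSet4_lt_top.ne eventually_twoScale_subset_domSet4_joint ?_
  filter_upwards [ae_not_boundary4 0] with w hw
  exact (mem_twoScale_eventually_iff_joint w hw).filter_mono nhdsWithin_le_nhds
set_option maxHeartbeats 400000 in
/-- ★★ The same along any parameter curve: if `η(t), ζ(t), κ(t) ≥ 0` tend to `0` along a filter `l`, then `vol³(T(η(t), ζ(t), κ(t))) → h(0)`. [folklore] -/
theorem tendsto_volume_twoScale_comp {ι : Type*} {l : Filter ι} {η ζ κ : ι → ℝ}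
    (hη : ∀ᶠ i in l, 0 ≤ η i) (hζ : ∀ᶠ i in l, 0 ≤ ζ i) (hκ : ∀ᶠ i in l, 0 ≤ κ i)
    (tη : Tendsto η l (𝓝 0)) (tζ : Tendsto ζ l (𝓝 0)) (tκ : Tendsto κ l (𝓝 0)) :
    Tendsto (fun i => (((volume : Measure ℍ).prod (volume : Measure ℍ)).prod (volume : Measure ℍ)) (twoScaleSet4 (η i) (ζ i) (κ i))) l
      (𝓝 ((((volume : Measure ℍ).prod (volume : Measure ℍ)).prod (volume : Measure ℍ)) (twoScaleSet4 0 0 0))) := by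
  have hT : Tendsto (fun i => (η i, (ζ i, κ i))) l (𝓝[octant3] (0 : ℝ × ℝ × ℝ)) := by
    refine tendsto_nhdsWithin_iff.2 ⟨?_, ?_⟩
    · exact tη.prodMk_nhds (tζ.prodMk_nhds tκ)
    · filter_upwards [hη, hζ, hκ] with i a b c
      exact ⟨a, b, c⟩
  exact tendsto_volume_twoScale_origin.comp hT

end Summit.QuantumFields.YangMills.Theorems.SwapVirialDeficit.ZeroModeGroup

end
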